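import Mathlib
import Literature.NumberTheory.NumberFields.PureCubicGenusRankLemmas
import Literature.NumberTheory.NumberFields.UnramifiedCyclicOddDegreeArtinMap
import Literature.NumberTheory.GaloisRepresentations.ArtinReciprocityPerPrime
import HarnessLib

/-!
# Genus theory for pure cubic fields: the `3`-rank bound — the unramified cubic layers

Topic `NumberTheory/NumberFields`.  Theorem-only file (no definition, no named fact, D-0026),
unconditional; continuation of `PureCubicGenusRankLemmas.lean`.  Inside an ambient Galois number
field `M/ℚ` with `σ⁶ = 1` for all `σ ∈ Gal(M/ℚ)`, containing a cube root `β` of `m`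
(`3 ∤ v_ℓ(m)`) and the roots of a cubic period polynomial `g` of the prime `ℓ ≡ 1 (mod 3)`:

* `Honda1971.cubicLayer` — **the layer `E = ℚ(β)(roots of g)` is a cyclic cubic extension of
  `K₁ = ℚ(β)` unramified at every finite prime** (the argument of `PureCubicGenusDivisor.lean`,
  steps (5)–(8): `[K₁ k(ℓ) : ℚ] = 9` as `X³ − m` has no root in the Galois cubic `k(ℓ)`; off `ℓ`
  the field `k(ℓ)` is unramified; above `ℓ` the inertia groups of `M` are cyclic of order `≤ 6 < 9
  = 3 · e(ℓ, K₁)` — the numerical Abhyankar lemma `isUnramifiedIn_compositum`);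
* `Honda1971.exists_artinMap_restrictNormalHom_eq` — for such a layer, the tree's Artin map
  `Φ : Cl(K₁) ↠ Gal(E/K₁)` (`exists_classGroup_monoidHom_surjective_galFrob_of_odd`, Cox Cor. 5.24)
  satisfies: every arithmetic Frobenius `φ ∈ Gal(M/K₁)` at a prime above `v` restricts on `E` to
  `Φ([v])` (consistency of Frobenii, `isArithFrobAt_restrictNormalHom_under`, and uniqueness of the
  Frobenius in the abelian unramified `E/K₁`, `eq_galFrob`).

## References

* M. Ishida, *The genus fields of algebraic number fields*, LNM 555 (1976), Ch. 7, Thm. 7, eq. (7.7). [Ishida1976]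
* T. Honda, J. Number Theory 3 (1971) 7–12, §1. [Honda1971]
* D. A. Cox, *Primes of the form x² + ny²*, 2nd ed. (2013), §5.C Cor. 5.24. [Cox2013]
-/

noncomputable section

open Polynomial NumberField IsDedekindDomain
open scoped IntermediateField nonZeroDivisors

namespace Literature.NumberTheory.NumberFields

namespace Honda1971

open Literature.NumberTheory.GaloisRepresentations

/-! ### The unramified cyclic cubic layer attached to one prime `ℓ` -/

/-- **The unramified cubic layer.**  Let `M/ℚ` be a Galois number field all of whose automorphisms
satisfy `σ⁶ = 1`, `β ∈ M` with `β³ = m`, `3 ∤ v_ℓ(m)` for a prime `ℓ ≡ 1 (mod 3)`, and `g ∈ ℚ[X]`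
a polynomial splitting in `M` whose root field `C₁ = ℚ(roots of g)` is a Galois cubic field
unramified (on `𝓞 M`) outside `ℓ`.  Then `E = ℚ(β)(roots of g)` is Galois of degree `3` over
`K₁ = ℚ(β)` and unramified at every finite prime of `K₁`. [cite: Honda1971, §1]
[cite: Ishida1976, Ch. 7 eq. (7.7)] -/
theorem cubicLayer {M : Type} [Field M] [NumberField M] [IsGalois ℚ M]
    (h6 : ∀ σ : M ≃ₐ[ℚ] M, σ ^ 6 = 1) {ℓ m : ℕ} (hℓ : ℓ.Prime) (hℓ1 : ℓ % 3 = 1)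
    (hm : ¬ 3 ∣ padicValNat ℓ m) {β : M} (hβ3 : β ^ 3 = (m : M)) {g : ℚ[X]}
    (hgsplit : (g.map (algebraMap ℚ M)).Splits)
    [hC₁gal : IsGalois ℚ (IntermediateField.adjoin ℚ (g.rootSet M))]
    (hC₁3 : Module.finrank ℚ (IntermediateField.adjoin ℚ (g.rootSet M)) = 3)
    (ha : ∀ (Q : Ideal (𝓞 M)) [Q.IsMaximal], (ℓ : 𝓞 M) ∉ Q →
      Algebra.IsUnramifiedAt ℤ (Q.under (𝓞 (IntermediateField.adjoin ℚ (g.rootSet M))))) :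
    IsGalois ℚ⟮β⟯ (IntermediateField.adjoin ℚ⟮β⟯ (g.rootSet M)) ∧
      Module.finrank ℚ⟮β⟯ (IntermediateField.adjoin ℚ⟮β⟯ (g.rootSet M)) = 3 ∧
      ∀ v : HeightOneSpectrum (𝓞 ℚ⟮β⟯),
        Algebra.IsUnramifiedIn (𝓞 (IntermediateField.adjoin ℚ⟮β⟯ (g.rootSet M))) v.asIdeal := by
  classical
  haveI : Fact ℓ.Prime := ⟨hℓ⟩
  have hℓ6 : ¬ ℓ ∣ 6 := by
    intro h
    have h23 : ℓ ∣ 2 * 3 := h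
    rcases (Nat.Prime.dvd_mul hℓ).mp h23 with h | h
    · have := (Nat.prime_dvd_prime_iff_eq hℓ Nat.prime_two).mp h
      omega
    · have := (Nat.prime_dvd_prime_iff_eq hℓ Nat.prime_three).mp h
      omega
  have hcube : ∀ b : ℚ, b ^ 3 ≠ (m : ℚ) := pow_three_ne_of_not_dvd_padicValNat hℓ hm
  have hℓG : ¬ ℓ ∣ Nat.card (M ≃ₐ[ℚ] M) := by
    intro hdvd
    obtain ⟨σ, hσ⟩ := exists_prime_orderOf_dvd_card' ℓ hdvd
    exact hℓ6 (hσ ▸ orderOf_dvd_of_pow_eq_one (h6 σ))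
  -- the polynomial `f₁ = X³ − m` and the field `K₁ = ℚ(β)`
  obtain ⟨f₁, hf₁def⟩ : ∃ f₁ : ℚ[X], f₁ = X ^ 3 - Polynomial.C (m : ℚ) := ⟨_, rfl⟩
  have hf₁monic : f₁.Monic := hf₁def ▸ monic_X_pow_sub_C _ (by norm_num)
  have hf₁0 : f₁ ≠ 0 := hf₁monic.ne_zero
  have hf₁deg : f₁.natDegree = 3 := by rw [hf₁def, natDegree_X_pow_sub_C]
  set K₁ : IntermediateField ℚ M := ℚ⟮β⟯ with hK₁def
  have hβint : IsIntegral ℚ β := .of_finite ℚ β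
  have hminβ : minpoly ℚ β = f₁ := by
    rw [hf₁def]; exact minpoly_eq_of_not_dvd_padicValNat (K := M) hℓ hm hβ3
  have hK₁3 : Module.finrank ℚ K₁ = 3 := by
    rw [hK₁def, IntermediateField.adjoin.finrank hβint, hminβ, hf₁deg]
  set βK : K₁ := ⟨β, IntermediateField.mem_adjoin_simple_self ℚ β⟩ with hβKdef
  have hβK : βK ^ 3 = (m : K₁) := Subtype.ext (by push_cast [hβKdef]; exact_mod_cast hβ3)
  set C₁ : IntermediateField ℚ M := IntermediateField.adjoin ℚ (g.rootSet M) with hC₁def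
  -- `E₂ = K₁(roots of g)`: Galois over `K₁`, `E₂ = K₁ C₁`
  set E₂ : IntermediateField K₁ M := IntermediateField.adjoin K₁ (g.rootSet M) with hE₂def
  have hE : E₂.restrictScalars ℚ = K₁ ⊔ C₁ :=
    IntermediateField.restrictScalars_adjoin_eq_sup ℚ K₁ (g.rootSet M)
  have hrootK : (g.map (algebraMap ℚ K₁)).rootSet M = g.rootSet M := by
    simp only [rootSet, aroots_def, Polynomial.map_map, ← IsScalarTower.algebraMap_eq]
  haveI : IsSplittingField K₁ E₂ (g.map (algebraMap ℚ K₁)) := by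
    have hsK : ((g.map (algebraMap ℚ K₁)).map (algebraMap K₁ M)).Splits := by
      rwa [Polynomial.map_map, ← IsScalarTower.algebraMap_eq]
    have := IntermediateField.adjoin_rootSet_isSplittingField hsK
    rwa [hrootK] at this
  haveI : Normal K₁ E₂ := Normal.of_isSplittingField (g.map (algebraMap ℚ K₁))
  haveI hE₂gal : IsGalois K₁ E₂ := { to_isSeparable := inferInstance, to_normal := inferInstance }
  -- `X³ - m` has no root in the Galois cubic field `C₁`, hence is irreducible over `C₁`
  have hirrC : Irreducible (f₁.map (algebraMap ℚ C₁)) := by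
    have hdeg : (f₁.map (algebraMap ℚ C₁)).natDegree = 3 := by rw [natDegree_map, hf₁deg]
    have hne : f₁.map (algebraMap ℚ C₁) ≠ 0 := Polynomial.map_ne_zero hf₁0
    rw [irreducible_iff_roots_eq_zero_of_degree_le_three (by omega) (by omega),
      Multiset.eq_zero_iff_forall_notMem]
    intro γ hγ
    rw [mem_roots hne, IsRoot.def, eval_map_algebraMap] at hγ
    have hγ3 : γ ^ 3 = (m : C₁) := by
      rw [hf₁def] at hγ
      simp only [map_natCast, aeval_sub, map_pow, aeval_X] at hγ
      exact sub_eq_zero.mp hγ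
    exact pow_three_ne_natCast_of_isGalois hC₁3 hcube γ hγ3
  -- degrees: `[K₁C₁ : ℚ] = 9`, hence `[E₂ : K₁] = 3`
  set E₃ : IntermediateField C₁ M := IntermediateField.adjoin C₁ {β} with hE₃def
  have hE' : E₃.restrictScalars ℚ = K₁ ⊔ C₁ :=
    (IntermediateField.restrictScalars_adjoin_eq_sup ℚ C₁ {β}).trans (sup_comm _ _)
  have hE₃3 : Module.finrank C₁ E₃ = 3 := by
    have hβintC : IsIntegral C₁ β := .of_finite C₁ β
    have hmin : minpoly C₁ β = f₁.map (algebraMap ℚ C₁) := by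
      refine (minpoly.eq_of_irreducible_of_monic hirrC ?_ (hf₁monic.map _)).symm
      rw [aeval_map_algebraMap, ← hminβ]
      exact minpoly.aeval ℚ β
    rw [hE₃def, IntermediateField.adjoin.finrank hβintC, hmin, natDegree_map, hf₁deg]
  have h9 : Module.finrank ℚ (E₃.restrictScalars ℚ) = 9 := by
    haveI : Module.Free C₁ E₃ := Module.Free.of_divisionRing C₁ E₃
    haveI : Module.Free ℚ C₁ := Module.Free.of_divisionRing ℚ C₁
    change Module.finrank ℚ E₃ = 9
    rw [← Module.finrank_mul_finrank ℚ C₁ E₃, hC₁3, hE₃3]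
  have h9' : Module.finrank ℚ (E₂.restrictScalars ℚ) = 9 := by
    rw [← h9]
    exact (IntermediateField.equivOfEq (hE.trans hE'.symm)).toLinearEquiv.finrank_eq
  have hE3 : Module.finrank K₁ E₂ = 3 := by
    haveI : Module.Free K₁ E₂ := Module.Free.of_divisionRing K₁ E₂
    haveI : Module.Free ℚ K₁ := Module.Free.of_divisionRing ℚ K₁
    have h := Module.finrank_mul_finrank ℚ K₁ E₂
    rw [hK₁3] at h
    change 3 * Module.finrank K₁ E₂ = Module.finrank ℚ (E₂.restrictScalars ℚ) at h
    rw [h9'] at h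
    omega
  -- above `ℓ`: `e(𝔔 | ℓ) = #I(𝔔) ≤ 6 < 9 = 3 e(𝔔 ∩ K₁ | ℓ)`
  have hb : ∀ (Q : Ideal (𝓞 M)) [Q.IsMaximal], (ℓ : 𝓞 M) ∈ Q →
      Q.ramificationIdx ℤ < 3 * (Q.under (𝓞 K₁)).ramificationIdx ℤ := by
    intro Q _ hℓQ
    haveI : (Q.under (𝓞 K₁)).IsMaximal := Ideal.IsMaximal.under _ Q
    have hne : Q.under (𝓞 K₁) ≠ ⊥ := Ideal.IsMaximal.ne_bot_of_isIntegral_int _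
    let v : HeightOneSpectrum (𝓞 K₁) :=
      ⟨Q.under (𝓞 K₁), Ideal.IsMaximal.isPrime inferInstance, hne⟩
    have hℓv : (ℓ : 𝓞 K₁) ∈ v.asIdeal := by
      change (ℓ : 𝓞 K₁) ∈ Q.under (𝓞 K₁)
      rw [Ideal.under_def, Ideal.mem_comap, map_natCast]
      exact hℓQ
    have he3 : (Q.under (𝓞 K₁)).ramificationIdx ℤ = 3 :=
      ramificationIdx_eq_three_of_not_dvd_padicValNat hℓ hm hK₁3 hβK v hℓv
    have hI : Q.ramificationIdx ℤ ≤ 6 := by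
      rw [← card_inertia_eq_ramificationIdx_int M (M ≃ₐ[ℚ] M) Q]
      haveI := isCyclic_inertia_of_not_dvd_card hℓ hℓG Q hℓQ
      obtain ⟨γ, hγ⟩ := IsCyclic.exists_ofOrder_eq_natCard (α := Q.inertia (M ≃ₐ[ℚ] M))
      rw [← hγ]
      refine Nat.le_of_dvd (by norm_num) (orderOf_dvd_of_pow_eq_one (Subtype.ext ?_))
      rw [Subgroup.coe_pow, Subgroup.coe_one]
      exact h6 γ
    omega
  have hunr : ∀ v : HeightOneSpectrum (𝓞 K₁), Algebra.IsUnramifiedIn (𝓞 E₂) v.asIdeal :=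
    isUnramifiedIn_compositum K₁ C₁ E₂ hE hE3 ha hb
  exact ⟨hE₂gal, hE3, hunr⟩

/-! ### The Artin map of a layer and the Frobenii of the ambient field -/

/-- **Artin map of an unramified cyclic cubic layer, and restriction of Frobenii.**  For
`E/K₁` Galois of degree `3`, unramified at every finite prime, inside the number field `M ⊇ E ⊇ K₁`:
the tree's Artin map `Φ : Cl(K₁) ↠ Gal(E/K₁)`, `Φ([𝔭]) = Frob_𝔭` (Cox Cor. 5.24), has the property
that every arithmetic Frobenius `φ ∈ Gal(M/K₁)` at a prime `𝔔 ∣ 𝔭` of `M` restricts on `E` to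
`Φ([𝔭])` ("`(𝔭, M/K₁)|_E = (𝔭, E/K₁)`", Childress Ch. 5 §1 Cor. 1.2).
[cite: Cox2013, §5.C Cor. 5.24 (PDF p. 124)] [cite: Childress2009, Ch. 5 §1 Cor. 1.2 (PDF p. 115)] -/
theorem exists_artinMap_restrictNormalHom_eq {M : Type} [Field M] [NumberField M]
    {K₁ : IntermediateField ℚ M} (E : IntermediateField K₁ M) [IsGalois K₁ E]
    (h3 : Module.finrank K₁ E = 3)
    (hunr : ∀ v : HeightOneSpectrum (𝓞 K₁), Algebra.IsUnramifiedIn (𝓞 E) v.asIdeal) :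
    ∃ Φ : ClassGroup (𝓞 K₁) →* (E ≃ₐ[K₁] E), Function.Surjective Φ ∧
      ∀ (v : HeightOneSpectrum (𝓞 K₁)) (Q : Ideal (𝓞 M)), Q ∈ v.asIdeal.primesOver (𝓞 M) →
        ∀ φ : M ≃ₐ[K₁] M, IsArithFrobAt (𝓞 K₁) φ Q →
          AlgEquiv.restrictNormalHom E φ =
            Φ (ClassGroup.mk0 ⟨v.asIdeal, mem_nonZeroDivisors_of_ne_zero (by
              rw [Submodule.zero_eq_bot]; exact v.ne_bot)⟩) := by
  classical
  haveI : FiniteDimensional K₁ E := Module.Finite.of_restrictScalars_finite ℚ K₁ E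
  have hcard : Nat.card (E ≃ₐ[K₁] E) = 3 := by rw [IsGalois.card_aut_eq_finrank, h3]
  haveI : Fact (Nat.Prime 3) := ⟨Nat.prime_three⟩
  haveI : IsCyclic (E ≃ₐ[K₁] E) := isCyclic_of_prime_card hcard
  have hodd : Odd (Module.finrank K₁ E) := h3 ▸ (by decide : Odd 3)
  obtain ⟨Φ, hΦsurj, hΦv⟩ :=
    exists_classGroup_monoidHom_surjective_galFrob_of_odd K₁ E hodd hunr
  refine ⟨Φ, hΦsurj, ?_⟩
  intro v Q hQ φ hφ
  rw [hΦv v]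
  have hcomm := commute_of_isCyclic_gal K₁ E
  exact eq_galFrob hcomm (hunr v) (ArtinConsistency.under_mem_primesOver_of_mem_primesOver hQ)
    (isArithFrobAt_restrictNormalHom_under hφ)

end Honda1971

end Literature.NumberTheory.NumberFields

end
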